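import Mathlib

/-!
# SoloInformed — the T*-row: the spin bit of an odd Klein twist, and the row's range of `d`

Kernel anchor for Part I-ter 5.12(f) (solo-informed s127, `work/s127/dichotomy.md`).

* `SoloInformed_johnson_form_on_rim_torus` — THEOREM E, algebraic core: a quadratic refinement `Q` of the
  mod-2 intersection form of the rim torus (Johnson's law `Q (x + y) = Q x + Q y + x·y`) that vanishes on the
  meridian `μ = (1,0)` (old fibre disc) and on the compressing-disc collar `λ = (0,1)` is `Q (a, b) = a * b`;
  so on the surgery slope `σ = p μ + q λ` it is `p q`, i.e. `q (mod 2)` for `p` odd: the Klein surgery with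
  slope `σ` is the manifold itself for `q` even and the Gluck twist for `q` odd.
* `SoloInformed_trow_slope_spin_bit` — every row member `σ(k) = (1 - 2k) μ + 4k λ` has `p` odd and `q` even,
  hence spin bit `0`: `X⁽ᴷ⁾(w; k) ≅ S⁴` for every `k` (given the inputs listed in 5.12(f)).
* `SoloInformed_trow_every_d_prime_to_six` — the orders `d = |6k + 1|`, `k ≠ 0`, exhaust all `d > 1` prime
  to `6` (with `SoloInformed_trow_d_coprime_six` of `SoloInformedTRowSlopes` this is the exact range of the row).
-/

namespace Summit.SmoothPoincare4.SmoothPoincare4.Theorems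

/-- The mod-2 intersection form of the torus in the basis `(μ, λ)`. -/
def SoloInformed_rimTorusForm (x y : ZMod 2 × ZMod 2) : ZMod 2 := x.1 * y.2 + x.2 * y.1

/-- THEOREM E (algebraic core). A Johnson quadratic form on `H₁(T_U; ℤ₂)` with `Q μ = Q λ = 0` is `(a,b) ↦ a b`. -/
theorem SoloInformed_johnson_form_on_rim_torus
    (Q : ZMod 2 × ZMod 2 → ZMod 2)
    (hQ : ∀ x y, Q (x + y) = Q x + Q y + SoloInformed_rimTorusForm x y)
    (hμ : Q (1, 0) = 0) (hl : Q (0, 1) = 0) :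
    ∀ a b : ZMod 2, Q (a, b) = a * b := by
  have hcases : ∀ a : ZMod 2, a = 0 ∨ a = 1 := by decide
  have h00 : Q (0, 0) = 0 := by
    have h := hQ (0, 0) (0, 0)
    simp only [SoloInformed_rimTorusForm, Prod.mk_add_mk, add_zero, mul_zero] at h
    generalize Q (0, 0) = z at h ⊢
    revert z; decide
  have h11 : Q (1, 1) = 1 := by
    have h := hQ (1, 0) (0, 1)
    simp only [SoloInformed_rimTorusForm, Prod.mk_add_mk, add_zero, zero_add, mul_zero, mul_one,
      hμ, hl] at h
    exact h
  intro a b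
  rcases hcases a with rfl | rfl <;> rcases hcases b with rfl | rfl <;> simp [h00, h11, hμ, hl]

/-- The spin bit of the slope `σ = p μ + q λ`: `Q σ = p q (mod 2)`; for `p` odd it is `q (mod 2)`. -/
theorem SoloInformed_slope_spin_bit
    (Q : ZMod 2 × ZMod 2 → ZMod 2)
    (hQ : ∀ x y, Q (x + y) = Q x + Q y + SoloInformed_rimTorusForm x y)
    (hμ : Q (1, 0) = 0) (hl : Q (0, 1) = 0) (p q : ℤ) (hp : Odd p) :
    Q ((p : ZMod 2), (q : ZMod 2)) = (q : ZMod 2) := by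
  rw [SoloInformed_johnson_form_on_rim_torus Q hQ hμ hl]
  obtain ⟨m, rfl⟩ := hp
  push_cast
  have h2 : (2 : ZMod 2) = 0 := by decide
  simp [h2]

/-- COROLLARY G (arithmetic): every member of the T*-row, slope `(1 - 2k) μ + 4k λ`, has spin bit `0`. -/
theorem SoloInformed_trow_slope_spin_bit
    (Q : ZMod 2 × ZMod 2 → ZMod 2)
    (hQ : ∀ x y, Q (x + y) = Q x + Q y + SoloInformed_rimTorusForm x y)
    (hμ : Q (1, 0) = 0) (hl : Q (0, 1) = 0) (k : ℤ) :
    Q (((1 - 2 * k : ℤ) : ZMod 2), ((4 * k : ℤ) : ZMod 2)) = 0 := by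
  have hp : Odd (1 - 2 * k) := ⟨-k, by ring⟩
  rw [SoloInformed_slope_spin_bit Q hQ hμ hl _ _ hp]
  push_cast
  have h4 : (4 : ZMod 2) = 0 := by decide
  simp [h4]

/-- The row's orders `d = |6k + 1|`, `k ≠ 0`, cover every `d > 1` prime to `6`. -/
theorem SoloInformed_trow_every_d_prime_to_six (d : ℕ) (hd : 1 < d) (h6 : Nat.Coprime d 6) :
    ∃ k : ℤ, k ≠ 0 ∧ ((d : ℤ) = 6 * k + 1 ∨ (d : ℤ) = -(6 * k + 1)) := by
  have h2 : ¬ 2 ∣ d := by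
    intro h
    have : 2 ∣ Nat.gcd d 6 := Nat.dvd_gcd h (by norm_num)
    rw [h6] at this
    omega
  have h3 : ¬ 3 ∣ d := by
    intro h
    have : 3 ∣ Nat.gcd d 6 := Nat.dvd_gcd h (by norm_num)
    rw [h6] at this
    omega
  have hmod : d % 6 = 1 ∨ d % 6 = 5 := by omega
  rcases hmod with h | h
  · exact ⟨((d / 6 : ℕ) : ℤ), by omega, Or.inl (by omega)⟩
  · exact ⟨-(((d + 1) / 6 : ℕ) : ℤ), by omega, Or.inr (by omega)⟩

end Summit.SmoothPoincare4.SmoothPoincare4.Theorems
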